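import Mathlib
import Summits.KontsevichZagierPeriods.Zeta5Search.WellPoisedFaceEnvelope
import HarnessLib.Audit
import HarnessLib

/-!
# The numerator-free face of Zudilin's `r = 3` boxes for the windows `{ζ(5)}`, `{ζ(5), ζ(7)}`:
# Gibbs tangents for the block rate and a Proposition-5 NO-GO at every height for `q ≤ 9`
# — cell `pub-zeta5`, class `odd` (gen 5), target T4 (structural no-go serving T2)

HONEST FRAMING: systematic search; no irrationality claim unless certified.  This file proves a NEGATIVE
(an envelope inequality on a whole face of a printed construction), not a candidate.

Provenance: family-designer seat `pub-zeta5-fam-odd-g5` (planner role; staged under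
`run/shared/lean/pub/pub-zeta5/lean/fam-odd/`, result of record `families/odd/FAMILY.md` §5.11) for VERBATIM
filing by the lane.  Not literature.  It extends the `q = 7` face theorem of `WellPoisedFaceEnvelope`
(class `vwp`, gen 6; imported: `blockRate`, `blockRate_eq_binEntropy`, `blockRate_le`) to `q = 8, 9`, which that
file records as out of reach of its argument ("`2 log 2 > 1`").  Companion integer file (independent of this
one): `WellPoisedFaceAliveBricks` — (8.9) for general `q` and the bound `ν_p ≤ #{alive bricks below h_q}`.

## Source (PRINTED)
W. Zudilin, *Arithmetic of linear forms involving odd zeta values*, J. Théor. Nombres Bordeaux 16 (2004)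
251–291 = arXiv:math/0206176, §8 [cite: Zudilin2004, §8: (8.6)–(8.9), Lemma 19, (8.13), Lemma 20, Prop. 5].
For odd `q ≥ 7`, `r = 3`, Lemma 19: `D_{m₁}^3 D_{m₂} ⋯ D_{m_{q−3}} · Φ⁻¹ · F(h) ∈ ℤζ(q−2) + ⋯ + ℤζ(5) + ℤ`,
`m_j = max{η₃, η₀ − 2η₄, η₀ − η₁ − η_{3+j}}` (p. 20), and Proposition 5: if `C₀ > C₂ = 3m₁ + m₂ + ⋯ + m_{q−3} −
(Φ-saving)` then one of `ζ(5), …, ζ(q−2)` is irrational.  Windows: `q = 7 ↦ {ζ(5)}`, `q = 9 ↦ {ζ(5), ζ(7)}`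
(target T2 of the cell), `q = 11 ↦ {ζ(5), ζ(7), ζ(9)}`, `q = 13 ↦` Zudilin's Theorem 3.

## Dictionary (scaled by `n` along (8.13); the NUMERATOR-FREE FACE is `η₁ = η₂ = η₃ = 0`, i.e. `h₁ = h₂ = h₃ = 1`)
* `FaceDirM M` : a face direction of the box with `q = M + 5` parameters, i.e. `B = M + 2` pole bricks:
  `(η₀; 0,0,0, a, mid₀, …, mid_{M−1}, d)` with `0 ≤ a ≤ mid_j ≤ d`, `2d < η₀` (`a = η₄` the smallest tail,
  `d = η_q` the largest; no ordering among the `mid_j` is required — a SUPERSET of Zudilin's ordered directions).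
* `FaceDirM.C0 = Σ_tails blockRate η₀ η_j` — the decay rate `−lim (1/n) log F(h)` ON THE FACE (boundary lemma of
  `families/vwp/FAMILY.md` §13.1, as in the `q = 7` file: the MEANING of `C0`, not a hypothesis of any theorem).
* `FaceDirM.mOf x = max{max{0, η₀ − 2a}, η₀ − x}` = `m_j` verbatim on the face; `delta = 3·mOf a + Σ_j mOf mid_j +
  mOf d` = the rate of Lemma 19's `D_{m₁}^3 D_{m₂} ⋯ D_{m_{q−3}}`.
* `FaceDirM.phiPlus = (η₀ − 2a) + Σ_j (η₀ − 2 mid_j)` — an UPPER bound for the `Φ`-saving rate `φ`: taking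
  `k = h_q` in (8.9) (legal: `h₄ ≤ h_q ≤ h₀ − h₄`), the top brick and every DEAD brick (`p > h₀ − 2h_j`) contribute
  `0` and every other brick `≤ 1`, so `ν_p ≤ #{j < q : p ≤ h₀ − 2h_j}` for every prime (`nuPq_face_le_alive` of the
  companion file, exact over `ℤ`), hence `Φ ≤ ∏_{j<q} (h₀ − 2h_j)#` and `φ ≤ phiPlus` by `θ(x) ∼ x` (PNT
  bookkeeping on paper, exactly as the `q = 7` file's `φ ≤ 3m₄`; `phiPlus ≤ 3m₄`-analogue `(B−1)·m_B` always).
## Results (all sorry-free)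
* `binEntropy_le_crossEntropy` (Gibbs: `H(p) ≤ −p log u − (1−p) log(1−u)`); `blockRate_le_tangent`
  (`g(η₀,η) ≤ η log((s+t)/s) + (η₀−2η) log((s+t)/t)`, any `s, t > 0`; `s = t` is the `q = 7` file's bound);
  `blockRate_add_le` : `g + η ≤ ((1 + log 2)/2)·η₀`;  `blockRate_sub_le` : `g − η ≤ log(4/3)·η₀` (tangent `(1,3)`);
  `log_four_thirds_le` : `log(4/3) ≤ 36/125`;  `blockRate_nonneg`.
* `FaceDirM.face_gap` : `C0 + (2 − log 2 − M·log(4/3))·η₀ ≤ delta − phiPlus` for EVERY `M` (the three bounds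
  above against the three rôles first / middle / top tail; only `m_j ≥ η₀ − η_{3+j}` of `mOf` is used);
  `gapConst_pos` : the constant is `> 0` iff `M ≤ 4`, i.e. `q ≤ 9`.
* `FaceDirM.face_noGo` (`M ≤ 4`): `C0 < delta − φ` for every `φ ≤ phiPlus` — Proposition 5's hypothesis `C₀ > C₂`
  FAILS at EVERY direction of the numerator-free face of the `q = 7, 8, 9` boxes and EVERY height `η₀` (given the
  dictionary), and so does the weaker requirement "the Lemma-19 forms tend to `0`": on this face the second-
  derivative mechanism can prove nothing about `{ζ(5), ζ(7)}`.  `face_kappa_le` (`1 ≤ M ≤ 4`):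
  `κ := C0/(delta − phiPlus) ≤ (2K + M − 1)/(M + 5)`, `K = 1 + log 2 + M log(4/3)`: float `0.7910` (`q = 7`, cf. the
  `q = 7` file's `0.9241`), `0.8890` (`q = 8`), `0.9653` (`q = 9`; certified `< 0.966` in `kappa9_bound_lt` from
  `log(4/3) ≤ 36/125`).  Kernel instance: the `q = 9` face MODEL maximiser `(93; 0³, 22, 25, 28, 31, 34, 37)` of
  `families/vwp/FAMILY.md` §14 (`modelFace9`).
## What is NOT proved here (paper / MODEL / float; FAMILY.md §5.11)
(i) the boundary lemma `C₀ = C0`; (ii) `φ ≤ phiPlus` from `ν_p ≤ #alive` (PNT); (iii) anything off the face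
(interior sup `κ₉ = 0.5960` is CERTIFIED-MODEL, `zeta5-calc/odd/SUPKAPPA.md`); (iv) `q = 10, 11` (`{ζ(5),ζ(7),ζ(9)}`):
the constant scheme stops exactly at `M log(4/3) < 2 − log 2`; the exact one-variable reduction of the same crude
ratio (float, this seat) gives face sups `0.650 / 0.748 / 0.836 / 0.916 / 0.987` for `q = 7 / 8 / 9 / 10 / 11` and
`1.11 > 1` for `q = 13` (where this crude bound says nothing; Theorem 3 is the INTERIOR point `η₁ = η₂ = η₃ = 27`
of that box), so `q = 10, 11` are true as float statements with margins `0.30 / 0.05` nats/`η₀` and would need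
`η₄`-dependent tangents; (v) Lemma 19 is printed for odd `q` ((8.5): `q, r` odd, `q ≥ r + 4`): for
`q = 8` the statement is the class-`odd` parity variant (FAMILY.md §1); the inequality itself is parity-blind.
-/

noncomputable section

open Real Finset

namespace Summit.KontsevichZagierPeriods.Zeta5Search

namespace WellPoisedFace

/-! ### 1. Gibbs tangents for the block rate -/

/-- **Gibbs' inequality** for the binary entropy (entropy `≤` cross-entropy against `Bernoulli(u)`):
`H(p) ≤ −p log u − (1 − p) log(1 − u)` for `0 ≤ p ≤ 1`, `0 < u < 1` (equality iff `u = p`). -/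
theorem binEntropy_le_crossEntropy {p u : ℝ} (hp0 : 0 ≤ p) (hp1 : p ≤ 1) (hu0 : 0 < u) (hu1 : u < 1) :
    binEntropy p ≤ -(p * log u) - (1 - p) * log (1 - u) := by
  have hu1' : 0 < 1 - u := by linarith
  have hlu : log u < 0 := Real.log_neg hu0 hu1
  have hl1u : log (1 - u) < 0 := Real.log_neg hu1' (by linarith)
  rcases hp0.eq_or_lt with h0 | hp0'
  · subst h0
    rw [binEntropy_zero]
    nlinarith
  rcases hp1.eq_or_lt with h1 | hp1'
  · subst h1
    rw [binEntropy_one]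
    nlinarith
  have hq : 0 < 1 - p := by linarith
  have h1 : p * log (u / p) ≤ p * (u / p - 1) :=
    mul_le_mul_of_nonneg_left (Real.log_le_sub_one_of_pos (div_pos hu0 hp0')) hp0
  have h2 : (1 - p) * log ((1 - u) / (1 - p)) ≤ (1 - p) * ((1 - u) / (1 - p) - 1) :=
    mul_le_mul_of_nonneg_left (Real.log_le_sub_one_of_pos (div_pos hu1' hq)) hq.le
  rw [Real.log_div hu0.ne' hp0'.ne', mul_sub] at h1
  rw [Real.log_div hu1'.ne' hq.ne', mul_sub] at h2
  have e1 : p * (u / p - 1) = u - p := by field_simp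
  have e2 : (1 - p) * ((1 - u) / (1 - p) - 1) = p - u := by field_simp; ring
  simp only [binEntropy, Real.log_inv]
  linarith

/-- **Gibbs TANGENT bound for the block rate.** For weights `s, t > 0` (tangency at `η/(η₀ − η) = s/(s+t)`):
`g(η₀, η) ≤ η·log((s+t)/s) + (η₀ − 2η)·log((s+t)/t)` (`0 ≤ η`, `2η < η₀`).  `s = t` gives the entropy bound
`(η₀ − η) log 2` of the `q = 7` file; `(s, t) = (1, 3)` is the middle-tail tangent used below. -/
theorem blockRate_le_tangent {η₀ η s t : ℝ} (hη : 0 ≤ η) (h2 : 2 * η < η₀) (hs : 0 < s) (ht : 0 < t) :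
    blockRate η₀ η ≤ η * log ((s + t) / s) + (η₀ - 2 * η) * log ((s + t) / t) := by
  rw [blockRate_eq_binEntropy hη h2]
  have hu : 0 < η₀ - η := by linarith
  have hst : 0 < s + t := by linarith
  have hp0 : 0 ≤ η / (η₀ - η) := div_nonneg hη hu.le
  have hp1 : η / (η₀ - η) ≤ 1 := by rw [div_le_one hu]; linarith
  have hG := binEntropy_le_crossEntropy hp0 hp1 (u := s / (s + t)) (div_pos hs hst)
    (by rw [div_lt_one hst]; linarith)
  have e1 : 1 - s / (s + t) = t / (s + t) := by field_simp; ring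
  have el1 : log (s / (s + t)) = -log ((s + t) / s) := by rw [← Real.log_inv, inv_div]
  have el2 : log (t / (s + t)) = -log ((s + t) / t) := by rw [← Real.log_inv, inv_div]
  rw [e1, el1, el2] at hG
  calc (η₀ - η) * binEntropy (η / (η₀ - η))
      ≤ (η₀ - η) * (η / (η₀ - η) * log ((s + t) / s) + (1 - η / (η₀ - η)) * log ((s + t) / t)) := by
        apply mul_le_mul_of_nonneg_left _ hu.le
        linarith
    _ = η * log ((s + t) / s) + (η₀ - 2 * η) * log ((s + t) / t) := by
        field_simp
        ring

/-- `0 ≤ g(η₀, η)` on the face range (`0 ≤ η`, `2η < η₀`). -/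
theorem blockRate_nonneg {η₀ η : ℝ} (hη : 0 ≤ η) (h2 : 2 * η < η₀) : 0 ≤ blockRate η₀ η := by
  rw [blockRate_eq_binEntropy hη h2]
  have hu : 0 < η₀ - η := by linarith
  exact mul_nonneg hu.le (binEntropy_nonneg (div_nonneg hη hu.le) (by rw [div_le_one hu]; linarith))

/-- **First / top tail.** `g(η₀, η) + η ≤ ((1 + log 2)/2)·η₀` (entropy bound plus `η < η₀/2`, `log 2 < 1`).
Float: `max_x (g(1,x) + x) = 0.79880` at `x = 0.35490`; the constant is `0.84657`. -/
theorem blockRate_add_le {η₀ η : ℝ} (hη : 0 ≤ η) (h2 : 2 * η < η₀) :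
    blockRate η₀ η + η ≤ (1 + log 2) / 2 * η₀ := by
  have h := blockRate_le hη h2
  have hl : log 2 < 1 := by
    have := Real.log_two_lt_d9
    norm_num at this
    linarith
  have hm : η * (1 - log 2) ≤ η₀ / 2 * (1 - log 2) :=
    mul_le_mul_of_nonneg_right (by linarith) (by linarith)
  linarith

/-- `log(4/3) ≤ 36/125 = 0.288` (float `0.28768`): `4/3 ≤ Σ_{i<5} x^i/i! ≤ exp x` at `x = 36/125`. -/
theorem log_four_thirds_le : log (4 / 3 : ℝ) ≤ 36 / 125 := by
  rw [Real.log_le_iff_le_exp (by norm_num)]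
  have h := Real.sum_le_exp_of_nonneg (show (0 : ℝ) ≤ 36 / 125 by norm_num) 5
  norm_num [Finset.sum_range_succ, Nat.factorial] at h
  linarith

/-- **Middle tails.** `g(η₀, η) − η ≤ log(4/3)·η₀` (Gibbs tangent `(s,t) = (1,3)`, then the coefficient of `η`,
`log 4 − 2 log(4/3) − 1 = 2 log(3/2) − 1`, is `≤ 0`).  Float: `max_x (g(1,x) − x) = 0.25158` at `x = 0.18196`. -/
theorem blockRate_sub_le {η₀ η : ℝ} (hη : 0 ≤ η) (h2 : 2 * η < η₀) :
    blockRate η₀ η - η ≤ log (4 / 3) * η₀ := by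
  have h := blockRate_le_tangent hη h2 (s := 1) (t := 3) one_pos (by norm_num)
  rw [show ((1 : ℝ) + 3) / 1 = 4 by norm_num, show ((1 : ℝ) + 3) / 3 = 4 / 3 by norm_num] at h
  have h4 : log (4 : ℝ) = 2 * log 2 := by
    rw [show (4 : ℝ) = 2 ^ 2 by norm_num, Real.log_pow]
    norm_num
  have h43 : log (4 / 3 : ℝ) = log 4 - log 3 := Real.log_div (by norm_num) (by norm_num)
  have h32 : log (3 / 2 : ℝ) = log 3 - log 2 := Real.log_div (by norm_num) (by norm_num)
  have h32' : log (3 / 2 : ℝ) ≤ 1 / 2 := by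
    have := Real.log_le_sub_one_of_pos (show (0 : ℝ) < 3 / 2 by norm_num)
    linarith
  have hX : 0 ≤ 1 - log 4 + 2 * log (4 / 3) := by linarith
  have hηX := mul_nonneg hη hX
  linarith

/-! ### 2. Face directions with `B = M + 2` pole bricks (`q = M + 5`), the envelope and the no-go -/

/-- A direction on the numerator-free face of Zudilin's `r = 3` box with `q = M + 5` parameters:
`(η₀; 0, 0, 0, a, mid₀, …, mid_{M−1}, d)`, `0 ≤ a ≤ mid_j ≤ d`, `2d < η₀` (`a = η₄`, `d = η_q`). -/
structure FaceDirM (M : ℕ) where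
  /-- `η₀` -/
  η₀ : ℝ
  /-- `η₄`, the smallest tail -/
  a : ℝ
  /-- `η₅, …, η_{q−1}`, the middle tails (any order) -/
  mid : Fin M → ℝ
  /-- `η_q`, the largest tail -/
  d : ℝ
  /-- `η₄ ≥ 0` -/
  ha : 0 ≤ a
  /-- `η₄` is the smallest tail -/
  hlo : ∀ j, a ≤ mid j
  /-- `η_q` is the largest tail -/
  hhi : ∀ j, mid j ≤ d
  /-- `η₄ ≤ η_q` (needed only when `M = 0`) -/
  had : a ≤ d
  /-- `η₀ > 2η_q` -/
  hd : 2 * d < η₀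

/-- The gap constant `2 − log 2 − M·log(4/3)` of the face envelope (`> 0` iff `M ≤ 4`; float `0.7315, 0.4438,
0.1561` for `M = 2, 3, 4` and `−0.13` for `M = 5`). -/
def gapConst (M : ℕ) : ℝ := 2 - log 2 - M * log (4 / 3)

/-- `gapConst M > 0` for `M ≤ 4` (`q ≤ 9`): `2 − 0.69315 − 4·0.288 = 0.1548 > 0`. -/
theorem gapConst_pos {M : ℕ} (hM : M ≤ 4) : 0 < gapConst M := by
  unfold gapConst
  have h43 := log_four_thirds_le
  have h43pos : 0 < log (4 / 3 : ℝ) := Real.log_pos (by norm_num)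
  have hM' : (M : ℝ) ≤ 4 := by exact_mod_cast hM
  have hl2 := Real.log_two_lt_d9
  have hmul : (M : ℝ) * log (4 / 3) ≤ 4 * log (4 / 3) := mul_le_mul_of_nonneg_right hM' h43pos.le
  norm_num at hl2 ⊢
  linarith

namespace FaceDirM

variable {M : ℕ} (D : FaceDirM M)

/-- `C₀` on the face: the sum of the `M + 2` block rates (meaning: the decay rate of `F(h)`, boundary lemma). -/
def C0 : ℝ := blockRate D.η₀ D.a + ∑ j, blockRate D.η₀ (D.mid j) + blockRate D.η₀ D.d

/-- `m_j = max{η₃, η₀ − 2η₄, η₀ − η₁ − η_{3+j}}` [Zudilin2004, p. 20] on the face, as a function of `x = η_{3+j}`. -/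
def mOf (x : ℝ) : ℝ := max (max 0 (D.η₀ - 2 * D.a)) (D.η₀ - x)

/-- `δ = 3m₁ + m₂ + ⋯ + m_{q−3}`: the rate of Lemma 19's `D_{m₁}^3 D_{m₂} ⋯ D_{m_{q−3}}` (`r = 3`). -/
def delta : ℝ := 3 * D.mOf D.a + ∑ j, D.mOf (D.mid j) + D.mOf D.d

/-- `φ⁺ = Σ_{j<q} (η₀ − 2η_j)`: the alive-brick upper bound for the `Φ`-saving rate (top brick excluded). -/
def phiPlus : ℝ := (D.η₀ - 2 * D.a) + ∑ j, (D.η₀ - 2 * D.mid j)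

/-- `η₀ − x ≤ mOf x` — the only property of Zudilin's `m_j` used below. -/
lemma mOf_ge (x : ℝ) : D.η₀ - x ≤ D.mOf x := le_max_right _ _

/-- `0 < η₀` for a face direction. -/
lemma η₀_pos : 0 < D.η₀ := by linarith [D.ha, D.had, D.hd]

/-- `2a < η₀`. -/
lemma two_a_lt : 2 * D.a < D.η₀ := by linarith [D.had, D.hd]

/-- `2·mid_j < η₀`. -/
lemma two_mid_lt (j : Fin M) : 2 * D.mid j < D.η₀ := by linarith [D.hhi j, D.hd]

/-- `0 ≤ C₀` on the face. -/
lemma C0_nonneg : 0 ≤ D.C0 := by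
  unfold C0
  have h1 := blockRate_nonneg D.ha D.two_a_lt
  have h2 := blockRate_nonneg (D.ha.trans D.had) D.hd
  have h3 : 0 ≤ ∑ j, blockRate D.η₀ (D.mid j) :=
    Finset.sum_nonneg fun j _ => blockRate_nonneg (D.ha.trans (D.hlo j)) (D.two_mid_lt j)
  linarith

/-- `Σ_j (η₀ − mid_j) = M·η₀ − Σ_j mid_j`. -/
lemma sum_sub_mid : ∑ j, (D.η₀ - D.mid j) = M * D.η₀ - ∑ j, D.mid j := by
  rw [Finset.sum_sub_distrib, Finset.sum_const, Finset.card_univ, Fintype.card_fin, nsmul_eq_mul]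

/-- `φ⁺ = (M+1)·η₀ − 2a − 2·Σ_j mid_j`. -/
lemma phiPlus_eq : D.phiPlus = (M + 1) * D.η₀ - 2 * D.a - 2 * ∑ j, D.mid j := by
  unfold phiPlus
  rw [Finset.sum_sub_distrib, Finset.sum_const, Finset.card_univ, Fintype.card_fin, nsmul_eq_mul,
    ← Finset.mul_sum]
  ring

/-- `δ ≥ 3(η₀ − a) + Σ_j (η₀ − mid_j) + (η₀ − d)` (from `m_j ≥ η₀ − η_{3+j}` only). -/
lemma delta_ge : 3 * (D.η₀ - D.a) + (M * D.η₀ - ∑ j, D.mid j) + (D.η₀ - D.d) ≤ D.delta := by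
  unfold delta
  have h1 := D.mOf_ge D.a
  have h2 := D.mOf_ge D.d
  have h3 : ∑ j, (D.η₀ - D.mid j) ≤ ∑ j, D.mOf (D.mid j) := Finset.sum_le_sum fun j _ => D.mOf_ge _
  rw [D.sum_sub_mid] at h3
  linarith

/-- `C₀ ≤ (1 + log 2 + M·log(4/3))·η₀ − a − d + Σ_j mid_j` (the three tangent bounds, tail by tail). -/
lemma C0_le : D.C0 ≤ (1 + log 2 + M * log (4 / 3)) * D.η₀ - D.a - D.d + ∑ j, D.mid j := by
  unfold C0
  have hA := blockRate_add_le D.ha D.two_a_lt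
  have hD := blockRate_add_le (D.ha.trans D.had) D.hd
  have hS : ∑ j, blockRate D.η₀ (D.mid j) ≤ ∑ j, (log (4 / 3) * D.η₀ + D.mid j) :=
    Finset.sum_le_sum fun j _ => by
      linarith [blockRate_sub_le (D.ha.trans (D.hlo j)) (D.two_mid_lt j)]
  rw [Finset.sum_add_distrib, Finset.sum_const, Finset.card_univ, Fintype.card_fin, nsmul_eq_mul] at hS
  linarith

/-- **FACE ENVELOPE (PROVED, every `M`).** `C₀ + (2 − log 2 − M·log(4/3))·η₀ ≤ δ − φ⁺`. -/
theorem face_gap : D.C0 + gapConst M * D.η₀ ≤ D.delta - D.phiPlus := by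
  have h1 := D.C0_le
  have h2 := D.delta_ge
  rw [D.phiPlus_eq]
  unfold gapConst
  linarith

/-- **NO-GO (PROVED, given the dictionary; `M ≤ 4`, i.e. `q ≤ 9`: windows `{ζ(5)}` and `{ζ(5), ζ(7)}`).**
For any `Φ`-saving rate `φ ≤ φ⁺` — in particular the true one — `C₀ < δ − φ`: Proposition 5's hypothesis
`C₀ > C₂` fails on the whole numerator-free face, at every height. -/
theorem face_noGo (hM : M ≤ 4) (φ : ℝ) (hφ : φ ≤ D.phiPlus) : D.C0 < D.delta - φ := by
  have h1 := D.face_gap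
  have h2 := mul_pos (gapConst_pos hM) D.η₀_pos
  linarith

/-- The net Lemma-19 rate is positive for `M ≤ 4`: `δ − φ − C₀ > 0` for every `φ ≤ φ⁺` — the integer multiples
`D_{m₁}^3 ⋯ D_{m_{q−3}} Φ⁻¹ F(h)` GROW exponentially on the face (so not even "forms → 0" holds). -/
theorem face_forms_grow (hM : M ≤ 4) (φ : ℝ) (hφ : φ ≤ D.phiPlus) : 0 < D.delta - φ - D.C0 := by
  linarith [D.face_noGo hM φ hφ]

/-- The Proposition-5 ratio on the face is `< 1` (`M ≤ 4`). -/
theorem face_kappa_lt_one (hM : M ≤ 4) : D.C0 / (D.delta - D.phiPlus) < 1 := by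
  have h1 := D.face_noGo hM D.phiPlus le_rfl
  have hpos : 0 < D.delta - D.phiPlus := by linarith [D.C0_nonneg]
  rwa [div_lt_one hpos]

/-- **κ ON THE FACE (PROVED, `1 ≤ M ≤ 4`).** `C₀/(δ − φ⁺) ≤ (2K + M − 1)/(M + 5)` with `K = 1 + log 2 + M log(4/3)`:
float `0.7910` (`q = 7`), `0.8890` (`q = 8`), `0.9653` (`q = 9`). -/
theorem face_kappa_le (hM1 : 1 ≤ M) (hM : M ≤ 4) :
    D.C0 / (D.delta - D.phiPlus) ≤ (2 * (1 + log 2 + M * log (4 / 3)) + M - 1) / (M + 5) := by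
  obtain ⟨K, hK⟩ : ∃ K : ℝ, K = 1 + log 2 + M * log (4 / 3) := ⟨_, rfl⟩
  obtain ⟨S, hS⟩ : ∃ S : ℝ, S = ∑ j, D.mid j - D.a - D.d := ⟨_, rfl⟩
  rw [← hK]
  have hC : D.C0 ≤ K * D.η₀ + S := by rw [hK, hS]; linarith [D.C0_le]
  have hΔ : 3 * D.η₀ + S ≤ D.delta - D.phiPlus := by
    rw [hS]; have := D.delta_ge; rw [D.phiPlus_eq]; linarith
  have hM1' : (1 : ℝ) ≤ M := by exact_mod_cast hM1
  have hM' : (M : ℝ) ≤ 4 := by exact_mod_cast hM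
  have hSle : 2 * S ≤ (M - 1) * D.η₀ := by
    have h1 : ∑ j, D.mid j ≤ ∑ _j : Fin M, D.d := Finset.sum_le_sum fun j _ => D.hhi j
    rw [Finset.sum_const, Finset.card_univ, Fintype.card_fin, nsmul_eq_mul] at h1
    have h2 : (M - 1) * D.d ≤ (M - 1) * (D.η₀ / 2) :=
      mul_le_mul_of_nonneg_left (by linarith [D.hd]) (by linarith)
    rw [hS]
    linarith [D.ha]
  have hKle : K ≤ 3 := by
    rw [hK]
    have hl2 := Real.log_two_lt_d9
    have h43 := log_four_thirds_le
    have h43pos : 0 < log (4 / 3 : ℝ) := Real.log_pos (by norm_num)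
    have hmul : (M : ℝ) * log (4 / 3) ≤ 4 * log (4 / 3) := mul_le_mul_of_nonneg_right hM' h43pos.le
    norm_num at hl2 ⊢
    linarith
  have hpos : 0 < D.delta - D.phiPlus := by linarith [D.C0_nonneg, D.face_noGo hM D.phiPlus le_rfl]
  have hK0 : 0 ≤ 2 * K + M - 1 := by
    have h1 : 0 < log (2 : ℝ) := Real.log_pos (by norm_num)
    have h2 : 0 ≤ (M : ℝ) * log (4 / 3) := mul_nonneg (by positivity) (Real.log_pos (by norm_num)).le
    rw [hK]
    linarith
  rw [div_le_div_iff₀ hpos (by positivity)]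
  have f1 : D.C0 * (M + 5) ≤ (K * D.η₀ + S) * (M + 5) := mul_le_mul_of_nonneg_right hC (by positivity)
  have f2 : 0 ≤ (3 - K) * ((M - 1) * D.η₀ - 2 * S) := mul_nonneg (by linarith) (by linarith)
  have f3 : (2 * K + M - 1) * (3 * D.η₀ + S) ≤ (2 * K + M - 1) * (D.delta - D.phiPlus) :=
    mul_le_mul_of_nonneg_left hΔ hK0
  nlinarith [f1, f2, f3]

/-! ### 3. Kernel instance: the `q = 9` face MODEL maximiser -/

/-- The `q = 9` (`M = 4`) face direction `(93; 0,0,0, 22, 25, 28, 31, 34, 37)` — the MODEL maximiser of the true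
`κ` on the `q = 9` face (`families/vwp/FAMILY.md` §14: MODEL `κ = 0.584`; crude ratio `C0/(δ − φ⁺) = 0.835` float). -/
def modelFace9 : FaceDirM 4 where
  η₀ := 93
  a := 22
  mid := ![25, 28, 31, 34]
  d := 37
  ha := by norm_num
  hlo := by
    intro j
    fin_cases j <;> simp <;> norm_num
  hhi := by
    intro j
    fin_cases j <;> simp <;> norm_num
  had := by norm_num
  hd := by norm_num

/-- At the MODEL maximiser: `φ⁺ = 185` and `δ = 523` (so the no-go reads `C0 < 338 − (185 − φ)`)… -/
theorem modelFace9_phiPlus_delta : modelFace9.phiPlus = 185 ∧ modelFace9.delta = 523 := by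
  constructor
  · simp only [phiPlus, modelFace9, Fin.sum_univ_four]
    simp
    norm_num
  · simp only [delta, mOf, modelFace9, Fin.sum_univ_four]
    simp
    norm_num

/-- … and Proposition 5 fails there at every height (instance of `face_noGo`). -/
example : modelFace9.C0 < modelFace9.delta - modelFace9.phiPlus := modelFace9.face_noGo le_rfl _ le_rfl

/-- The proved `κ` bound at `q = 9` is below `1`: float `(2(1 + log 2 + 4 log(4/3)) + 3)/9 = 0.9653`; certified
`< 0.966` here from `log(4/3) ≤ 36/125` and `log 2 < 0.6931471808`. -/
theorem kappa9_bound_lt : (2 * (1 + log 2 + 4 * log (4 / 3)) + 4 - 1) / (4 + 5) < (0.966 : ℝ) := by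
  have hl2 := Real.log_two_lt_d9
  have h43 := log_four_thirds_le
  norm_num at hl2 ⊢
  linarith

end FaceDirM

end WellPoisedFace

end Summit.KontsevichZagierPeriods.Zeta5Search
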